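import Mathlib

/-!
# Census-b1 checks (crux `DescentPerfectToAll`, stmt-ResolutionOfSingularities-0549) — machine-checked side facts

STRATEGY-CENSUS-b1 §3.1 (ii) / §4.2 (N-h). Let `μ_p` act diagonally on a regular surface germ with weights
`(a, b)`, `ab ≠ 0` — equivalently a multiplicative `p`-closed vector field `D = a·x∂_x + b·y∂_y`, the local
end form of `sat(∂_α)` / of any log-canonical rank-1 `p`-closed foliation at a singular point (eigen-parameters:
`Picover.EigenParameters.exists_eigen_regularParameters`, landed). The quotient germ is regular iff `ab = 0`
(pseudo-reflection). Blowing up the (reduced, `D`-invariant, regular) fixed point gives, on the two charts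
`(x, y/x)` and `(x/y, y)`, the vector fields `a·x∂_x + (b − a)·y′∂_{y′}` and `(a − b)·x′∂_{x′} + b·y∂_y`, i.e. new
fixed points of weight types `(a, b − a)` and `(a − b, b)` when `a ≠ b` (when `a = b` the exceptional curve is
fixed pointwise and both charts are pseudo-reflections). Types are taken modulo `(a,b) ∼ (ca, cb)` (change of
generator of `μ_p`) and `(a,b) ∼ (b,a)`; writing a type as `(1, q)`, `q = b/a`, its class is `{q, q⁻¹}` and its
two children are the classes of `q − 1` and of `q⁻¹ − 1`. The class of `q = 1` (balanced type `(1,1)`) is the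
SINK: its children are pseudo-reflections. CLAIM: for `p ≥ 5` every class other than the sink has a child that
is neither the sink nor resolved, so the tree of fixed-point blow-ups is infinite for every unbalanced type —
"keep blowing up regular invariant centres on the top until the quotient is regular" does not terminate; the
toroidal endgame must be done downstairs (toric subdivision = weighted / stacky blow-ups upstairs). For
`p ∈ {2, 3}` every child of every class is the sink or resolved (finite trees). Below: the general statement for
all primes `p ≥ 5` (three-line proof), `decide`d instances, the `p = 3` finiteness, and the `p = 5`
self-reproduction `(1,2) ∼ (1,3)` used in the census text.
-/

set_option linter.dupNamespace false

namespace Summit.ResolutionOfSingularities.ResolutionOfSingularities.Cruxes.DescentPerfectToAll.CensusB1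

/-- For every prime `p ≥ 5` and every unit `q ≠ 1` of `𝔽_p` (with inverse `r`), one of the two children
`q − 1`, `r − 1` of the weight class `[q]` is neither the sink `1` nor `0`: the fixed-point blow-up tree of an
unbalanced diagonal `μ_p`-surface germ is infinite. [folklore] -/
theorem exists_nonsink_child (p : ℕ) [hp : Fact p.Prime] (h5 : 5 ≤ p) (q r : ZMod p) (hqr : q * r = 1)
    (hq1 : q ≠ 1) : (q - 1 ≠ 1 ∧ q - 1 ≠ 0) ∨ (r - 1 ≠ 1 ∧ r - 1 ≠ 0) := by
  by_cases hq : q - 1 = 1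
  · right
    have hq2 : q = 2 := by linear_combination hq
    subst hq2
    refine ⟨fun hr => ?_, fun hr => ?_⟩
    · have hr2 : r = 2 := by linear_combination hr
      subst hr2
      -- 2 * 2 = 1 in ZMod p forces p ∣ 3
      have h3 : ((3 : ℕ) : ZMod p) = 0 := by
        have : (2 : ZMod p) * 2 - 1 = 0 := by rw [hqr, sub_self]
        have e : ((3 : ℕ) : ZMod p) = (2 : ZMod p) * 2 - 1 := by push_cast; ring
        rw [e, this]
      rw [ZMod.natCast_eq_zero_iff] at h3
      have := Nat.le_of_dvd (by norm_num) h3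
      omega
    · have hr1 : r = 1 := by linear_combination hr
      subst hr1
      have h1 : (2 : ZMod p) = 1 := by simpa using hqr
      have h0 : ((1 : ℕ) : ZMod p) = 0 := by
        have : (2 : ZMod p) - 1 = 0 := by rw [h1, sub_self]
        have e : ((1 : ℕ) : ZMod p) = (2 : ZMod p) - 1 := by push_cast; ring
        rw [e, this]
      rw [ZMod.natCast_eq_zero_iff] at h0
      have := Nat.le_of_dvd (by norm_num) h0
      omega
  · left
    refine ⟨hq, fun h0 => hq1 ?_⟩
    linear_combination h0

/-- `decide`d instance, `p = 5`. [folklore] -/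
theorem nonsink_child_five : ∀ q r : ZMod 5, q * r = 1 → q ≠ 1 →
    (q - 1 ≠ 1 ∧ q - 1 ≠ 0) ∨ (r - 1 ≠ 1 ∧ r - 1 ≠ 0) := by decide

/-- `decide`d instance, `p = 7`. [folklore] -/
theorem nonsink_child_seven : ∀ q r : ZMod 7, q * r = 1 → q ≠ 1 →
    (q - 1 ≠ 1 ∧ q - 1 ≠ 0) ∨ (r - 1 ≠ 1 ∧ r - 1 ≠ 0) := by decide

/-- `decide`d instance, `p = 11`. [folklore] -/
theorem nonsink_child_eleven : ∀ q r : ZMod 11, q * r = 1 → q ≠ 1 →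
    (q - 1 ≠ 1 ∧ q - 1 ≠ 0) ∨ (r - 1 ≠ 1 ∧ r - 1 ≠ 0) := by decide

/-- `decide`d instance, `p = 13`. [folklore] -/
theorem nonsink_child_thirteen : ∀ q r : ZMod 13, q * r = 1 → q ≠ 1 →
    (q - 1 ≠ 1 ∧ q - 1 ≠ 0) ∨ (r - 1 ≠ 1 ∧ r - 1 ≠ 0) := by decide

/-- `p = 3`: every child of every unbalanced class is the sink or resolved (the only unbalanced class is
`[2] = [(1,2)] = A₂`-type, both children equal `1`): finite trees, fixed-point blow-ups DO regularise
`μ_3`-surface quotients. [folklore] -/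
theorem all_children_sink_three : ∀ q r : ZMod 3, q * r = 1 → q ≠ 1 →
    (q - 1 = 1 ∨ q - 1 = 0) ∧ (r - 1 = 1 ∨ r - 1 = 0) := by decide

/-- `p = 2`: there is no unbalanced class at all. [folklore] -/
theorem no_unbalanced_two : ∀ q r : ZMod 2, q * r = 1 → q = 1 := by decide

/-- The self-reproduction quoted in the census (`p = 5`): the child `(1, 2)` of the type `(1, 3)` is equivalent
to `(1, 3)` (scale by `c = 3` and swap: `3·(1,2) = (3,1)`), so a `(1/5)(1,3)` point reappears after every blow-up
of the fixed point. [folklore] -/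
theorem reproduces_five : ∃ c : ZMod 5, c ≠ 0 ∧ c * 1 = 3 ∧ c * 2 = 1 := by decide

/-- And `(1,3)`'s children are `(1, 3 - 1) = (1, 2)` and `(1 - 3, 3) = (3, 3) ∼ (1, 1)` (the sink). [folklore] -/
theorem children_of_one_three_five : ((3 : ZMod 5) - 1 = 2) ∧ ((1 : ZMod 5) - 3 = 3) := by decide

end Summit.ResolutionOfSingularities.ResolutionOfSingularities.Cruxes.DescentPerfectToAll.CensusB1
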